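/-
Origin: expansion seat `planner-pub-hodgecm-pv08-g13-0`, handover #1 v3 2026-08-18T13:47Z md5 723b5e8f (SUPERSEDES pv08-g11 v2 52ac6e21 IN PLACE, same target: import-line-only change l.9 `import Prl1g6.AllChars` -> tree `import HodgeCM.Automorphic.SignRecipeEndStateAllChars` (prl1-g6 cf1d2c24, LANDED r29); code byte-identical below; authored pv08-g11, handed by lineage bounce-duty successor pv08-g13; NEW additive leaf; imports tree modules only (PerL34.OpenInput (`HOME/pub-hodgecm-pv08-g13/lean/Pv08g13/OpenInputsN19AllChars.lean`, md5 723b5e8f, 332 lines);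
landed by the gen-8 packager in gate run 30 as `HodgeCM/PerL34/OpenInputsN19AllChars.lean` (verbatim).
-/
/-
Copyright: pub-hodgecm formalisation cell (harness21, 2026). New file (not vendored).
Origin: unit pub-hodgecm-pv08-g11 (DAG-NODE PROVER #08 gen 11), node N19 addendum to the all-characters END STATE
(`HodgeCM/Automorphic/SignRecipeEndStateAllChars.lean`, unit pub-hodgecm-prl1-g6).
Proposed place: `HodgeCM/PerL34/OpenInputsN19AllChars.lean` (ONE NEW FILE, additive leaf; nothing imports it).
Import rewrite at landing: `import Prl1g6.AllChars` ↦ `import HodgeCM.Automorphic.SignRecipeEndStateAllChars`.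
-/
import Summits.HodgeConjecture.HodgeCM.PerL34.OpenInputsN19
import Summits.HodgeConjecture.HodgeCM.Automorphic.SignRecipeEndStateAllChars_2

set_option autoImplicit false

/-!
# The two N19 binders of the all-characters END STATE, BY NAME, from node N19's residual cores — `chars`-free

`SignRecipeEndStateAllChars` (unit prl1-g6) instantiates PerL Def 3.2's allowed-pair predicate by `fun _ => True`
(`TorusData.allChars`, `ThetaModel.allChars`), so that the input `Open_chars` (node N31 = PerL v5 Lemma 4.2(b)) is a
theorem and the END STATE `Assembly.realisationExists_ofSignRecipe₇` has SEVEN non-design inputs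
(`ThetaModel.AllCharsNonDesign`), among them the two torus-side inputs in all-characters form

* `Open_thetaGen12All` — N19w with the larger target `S₁₂^all = closure (span {ϑ_{T,χ}(Φ) : ALL χ of type w, Φ})`;
* `Open_thetaReal34All` — N19g (closure form) for EVERY character `χ` of `[T']` of type `w'`.

`OpenInputsN19` (unit pv08, node N19) derived the two torus-side inputs OF RECORD from node N19's RESIDUAL CORES
(`S12Wedges`): `Open_thetaGen12 ⇐` the (12)-side seesaw-generator identity `N19w_genIdentity` + `Open_chars`, and
`Open_thetaReal34 ⇐` the (34)-side finite-sum core on a dense subspace `N19g_core` (density + AX5b, `N19g_of`).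

THIS FILE does the same for the all-characters END STATE and records exactly what its two N19 binders cost in the
vocabulary of node N19:

* `ThetaModel.open_thetaGen12All_of_genIdentity` : (∀ good contexts, `N19w_genIdentity T V c (T.t12 V c) 0 1`)
  `→ T.Open_thetaGen12All` — the BARE (12)-side generator identity (PerL ll. 372–375 with Lemma 3.4 (eq:seesaw),
  node N17's print heart: every wedge-function `Λ_Γ(ω, ω')` IS a generator `ϑ_{T,χ}(Φ)` for SOME `χ` of type `w`)
  suffices; NO allowedness input at all on the (12) side (`S₁₂^all` contains every generator);
* `ThetaModel.open_thetaReal34All_of_coreAll` : (∀ good contexts, `N19g_coreAll T V c (T.t34 V c) 2 3`)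
  `→ T.Open_thetaReal34All` — the finite-sum core on a dense subspace for EVERY character of type `w'`
  (`PerL34.N19g_coreAll`, this file), by density and the continuity AX5b exactly as in `N19g_of`
  (`PerL34.N19gAll_of` = `N19g_of` at `D.allChars`).

So the all-characters END STATE reads, with its two N19 binders in residual-core form
(`ThetaModel.CoresNonDesign`, `Assembly.realisationExists_ofSignRecipe₇_ofCores`):

  `RealisationExistsPerL ∧ RealisationExistsFace ⇐ M ∧ embCover ∧ innerEmb [PRINT] ∧ thetaSub (N12) ∧ thetaWedge (N33)
     ∧ (12)-generator identity (N19w core = N17) ∧ (34)-finite-sum core for all χ (N19g^all core) ∧ occ (N29) ∧ HR`.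

The cores are a COMMON REFINEMENT of both END STATES: with `Open_chars` added they give the eight inputs of record
(`ThetaModel.CoresNonDesign.nonDesignInputs`, via `OpenInputsN19`), without it the seven all-characters inputs
(`ThetaModel.CoresNonDesign.allCharsNonDesign`).

FIDELITY CLAUSE (what `N19g_coreAll` asserts beyond PerL v5 Lemma 3.5 as written; adversarial reader 2, GAPS.md C71).
For an ALLOWED character `χ` of type `w'`, `N19g_coreAll` is Lemma 3.5's own finite-sum mechanism (tex ll. 356–372:
for `Φ ∈ pr_κ(𝒫)` the seesaw identity (eq:seesaw) writes `ϑ_{T',χ}(Φ)` as a finite sum of products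
`θ_{φ₃}(χ'₃) θ_{φ₄}(χ'₄)`, each the scalar function of a wedge `u₃ ∧ u₄` of theta one-forms of types `Ψ₃, Ψ₄`).  For a
NON-allowed `χ` of type `w'` the seesaw identity still holds, but that the factors `θ_{φᵢ}(χ'ᵢ)` are (functions
of) holomorphic theta ONE-FORMS of type `Ψᵢ` is Def 3.2 (β) ("all constituents of the lift lie in `𝒜^{1,0}`"),
which PerL supplies for every character of type `w'` only through Lemma 4.2(b)(β) ← Lemma 4.1(b) (and when
Def 3.2 (α) fails the products vanish).  Hence `N19g_coreAll` = Lemma 3.5's core + Lemma 4.2(b)(β) for type-`w'`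
characters: the ANALYTIC half (α) of node N31 (Rallis inner product formula, local non-vanishing, ε-dichotomy) is
consumed nowhere in this END STATE; the (β) half is charged here, to the (34)-side core, and nowhere else.
Monotonicity is kernel-checked both ways round: `N19g_coreAll → N19g_core` (`N19g_core_of_coreAll`) and
`N19g_core ∧ N19_charsIn → N19g_coreAll` (`N19g_coreAll_of_core`).

NOT provable in the package (no Weil-representation / Fock-model vocabulary, LEMMAS.md §3 D4/D5): the two cores stay
named residual INPUTS, as in `S12Wedges` / `OpenInputsN19`; see HOME/GAPS.md entries pv08/N19, pv08g7-K1, pv08g11-K1.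
Nothing is posited; no new data; no new cited fact.  Imports `HodgeCM.*` only.
-/

noncomputable section

open scoped InnerProductSpace

namespace HodgeCM

/-! ## Side-generic: the residual cores of a torus side with every character allowed -/

namespace PerL34

open HodgeCM.Prior.Perl34File

variable {U : Universe} (T : U.ThetaModel)
variable {L : CMField} {ι₁ : L →+* ℂ} (V : HermSpace3 L ι₁) (c : SeesawCtx L)
variable (D : Perl34.TorusData (T.core V c)) (k l : Fin 4)

/-- **Residual INPUT, all-characters form = the finite-sum core on a dense subspace for EVERY character of the side's
archimedean type** (PerL v5 ll. 356–372 for allowed `χ`; + Lemma 4.2(b)(β) for the others — FIDELITY CLAUSE in the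
module docstring): there is a dense `P ⊆ 𝒮^κ` (PerL: `P = pr_κ(𝒫)`, `𝒫` the Fock polynomials) such that for every
character `χ ∈ X` and every `Φ ∈ P` the generator `ϑ_{T,χ}(Φ)` is a FINITE linear combination of wedge-functions of
theta one-forms of types `Ψ_k, Ψ_l`.  `N19g_core` is this statement restricted to allowed `χ`. -/
def N19g_coreAll : Prop :=
  ∃ P : Set (T.SK V c), Dense P ∧
    ∀ (χ : D.X), ∀ Φ ∈ P, D.ϑ χ Φ ∈ Submodule.span ℂ (T.wedgeSet V c k l)

/-- **(gen ⊆ closed wedge span) for EVERY character** of the side (closure form): the body of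
`ThetaModel.Open_thetaReal34All` for the side `(T.t34 V c, 2, 3)`.  `N19_genIn` is this statement restricted to
allowed `χ`. -/
def N19_genInAll : Prop :=
  ∀ (χ : D.X) (Φ : T.SK V c), D.ϑ χ Φ ∈ (Submodule.span ℂ (T.wedgeSet V c k l)).topologicalClosure

/-- The all-characters core of `D` IS the core of record of `D.allChars` (every character allowed). -/
theorem N19g_coreAll_iff_core_allChars : N19g_coreAll T V c D k l ↔ N19g_core T V c D.allChars k l :=
  ⟨fun ⟨P, hP, h⟩ => ⟨P, hP, fun χ _ Φ hΦ => h χ Φ hΦ⟩, fun ⟨P, hP, h⟩ => ⟨P, hP, fun χ Φ hΦ => h χ trivial Φ hΦ⟩⟩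

/-- (gen ⊆) for every character of `D` IS (gen ⊆) of record for `D.allChars`. -/
theorem N19_genInAll_iff_genIn_allChars : N19_genInAll T V c D k l ↔ N19_genIn T V c D.allChars k l :=
  ⟨fun h χ _ Φ => h χ Φ, fun h χ Φ => h χ trivial Φ⟩

/-- The seesaw-generator identity does not mention `allowed`: it is the same statement for `D` and `D.allChars`. -/
theorem N19w_genIdentity_allChars_iff : N19w_genIdentity T V c D.allChars k l ↔ N19w_genIdentity T V c D k l :=
  Iff.rfl

/-- Node N31's output for the side `D.allChars` holds by `trivial`. -/
theorem N19_charsIn_allChars : N19_charsIn T V c D.allChars := fun _ => trivial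

/-- MONOTONICITY: the all-characters core gives the core of record. -/
theorem N19g_core_of_coreAll (h : N19g_coreAll T V c D k l) : N19g_core T V c D k l :=
  let ⟨P, hP, hspan⟩ := h
  ⟨P, hP, fun χ _ Φ hΦ => hspan χ Φ hΦ⟩

/-- … and the core of record together with node N31's output for the side gives the all-characters core. -/
theorem N19g_coreAll_of_core (hcore : N19g_core T V c D k l) (hch : N19_charsIn T V c D) :
    N19g_coreAll T V c D k l :=
  let ⟨P, hP, hspan⟩ := hcore
  ⟨P, hP, fun χ Φ hΦ => hspan χ (hch χ) Φ hΦ⟩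

/-- Under node N31's output for the side the two cores coincide. -/
theorem N19g_coreAll_iff_core_of_charsIn (hch : N19_charsIn T V c D) :
    N19g_coreAll T V c D k l ↔ N19g_core T V c D k l :=
  ⟨N19g_core_of_coreAll T V c D k l, fun h => N19g_coreAll_of_core T V c D k l h hch⟩

/-- (gen ⊆) for every character gives (gen ⊆) of record. -/
theorem N19_genIn_of_genInAll (h : N19_genInAll T V c D k l) : N19_genIn T V c D k l :=
  fun χ _ Φ => h χ Φ

/-- **(gen ⊆ closed wedge span) for EVERY character, PROVED from the all-characters core** — PerL ll. 358–359 "by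
continuity of `\vartheta_{T,\chi}` it suffices to treat `\Phi\in\mathrm{pr}_\kappa(\mathcal P)`": `N19g_of` (density
of `P` + the continuity AX5b + the bounded inclusion `C([G_U]) ⊂ L²`) at the side `D.allChars`. -/
theorem N19gAll_of (hcore : N19g_coreAll T V c D k l) : N19_genInAll T V c D k l :=
  (N19_genInAll_iff_genIn_allChars T V c D k l).mpr
    (N19g_of T V c D.allChars k l ((N19g_coreAll_iff_core_allChars T V c D k l).mp hcore))

/-- **(wedge ⊆ S^all) PROVED from the BARE seesaw-generator identity** — no allowedness input: every generator
`ϑ_{T,χ}(Φ)`, `χ ∈ X`, lies in `S^all` (`N19w_of` at the side `D.allChars`, whose `N19_charsIn` is `trivial`). -/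
theorem N19w_allChars_of_genIdentity (hgen : N19w_genIdentity T V c D k l) : N19_wedgeIn T V c D.allChars k l :=
  N19w_of T V c D.allChars k l hgen (N19_charsIn_allChars T V c D)

/-- **NODE N19's statement SHAPE (Lemma 3.5 (i)) at the all-characters side `D.allChars`, from the two cores ALONE**
(`S^all = closed span of the (k,l)-wedges`): seesaw-generator identity (N17 residue) + all-characters finite-sum
core; node N31 is not an input.  By the FIDELITY CLAUSE the all-characters core carries Lemma 4.2(b)(β) for the
non-allowed characters, so this is Lemma 3.5 (i) transported to `S^all` (DIVERGENCE.md prl1g6-D1), not Lemma 3.5 (i)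
as written (which is `N19_of_cores` at `D` itself, with `N19_charsIn`). -/
theorem N19_statement_allChars_of_cores (hgen : N19w_genIdentity T V c D k l) (hcore : N19g_coreAll T V c D k l) :
    N19_statement T V c D.allChars k l :=
  N19_of_cores T V c D.allChars k l hgen (N19_charsIn_allChars T V c D)
    ((N19g_coreAll_iff_core_allChars T V c D k l).mp hcore)

end PerL34

/-! ## Model level: the two all-characters inputs BY NAME from the cores -/

namespace Universe

open HodgeCM.Prior.Perl34File HodgeCM.Prior.Perl34File.Perl34 HodgeCM.PerL34

variable {U : Universe}

namespace ThetaModel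

variable (T : U.ThetaModel)

/-- **`Open_thetaGen12All` from the BARE (12)-side seesaw-generator identity** (node N17 residue; PerL v5 Lemma 3.5,
ll. 372–375 "conversely every such wedge is a generator") — NO `Open_chars`: the wedge IS a generator `ϑ_{T,χ}(Φ)`
for some `χ` of type `w`, hence lies in `S₁₂^all`.  Compare `PerL34.open_thetaGen12_of_genIdentity`, which needs
`Open_chars` to land in the smaller `S₁₂`. -/
theorem open_thetaGen12All_of_genIdentity
    (hgen : ∀ {L : CMField} {ι₁ : L →+* ℂ} (V : HermSpace3 L ι₁) (c : SeesawCtx L), T.GoodCtx ι₁ c →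
      N19w_genIdentity T V c (T.t12 V c) 0 1) :
    T.Open_thetaGen12All := by
  intro L ι₁ V c hc Γ ω₁ ω₂ h₁ h₂
  have h' : T.Λ Γ ω₁ ω₂ ∈ (T.t12 V c).allChars.S12 :=
    N19w_allChars_of_genIdentity T V c (T.t12 V c) 0 1 (hgen V c hc) Γ ω₁ ω₂ h₁ h₂
  rwa [TorusData.allChars_S12] at h'

/-- The same implication read on the all-characters model: `Open_thetaGen12` of `T.allChars` from the bare
generator identity (through `allChars_thetaGen12_iff`). -/
theorem allChars_open_thetaGen12_of_genIdentity
    (hgen : ∀ {L : CMField} {ι₁ : L →+* ℂ} (V : HermSpace3 L ι₁) (c : SeesawCtx L), T.GoodCtx ι₁ c →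
      N19w_genIdentity T V c (T.t12 V c) 0 1) :
    T.allChars.Open_thetaGen12 :=
  (T.allChars_thetaGen12_iff).mpr (T.open_thetaGen12All_of_genIdentity hgen)

/-- **`Open_thetaReal34All` from the (34)-side finite-sum core for EVERY character of type `w'`** (PerL v5
ll. 356–372 + the FIDELITY CLAUSE), by density and the continuity AX5b (`PerL34.N19gAll_of`). -/
theorem open_thetaReal34All_of_coreAll
    (h : ∀ {L : CMField} {ι₁ : L →+* ℂ} (V : HermSpace3 L ι₁) (c : SeesawCtx L), T.GoodCtx ι₁ c →
      N19g_coreAll T V c (T.t34 V c) 2 3) :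
    T.Open_thetaReal34All :=
  fun V c hc χ Φ => N19gAll_of T V c (T.t34 V c) 2 3 (h V c hc) χ Φ

/-- The same implication read on the all-characters model: `Open_thetaReal34` of `T.allChars` from the
all-characters core (through `allChars_thetaReal34_iff`). -/
theorem allChars_open_thetaReal34_of_coreAll
    (h : ∀ {L : CMField} {ι₁ : L →+* ℂ} (V : HermSpace3 L ι₁) (c : SeesawCtx L), T.GoodCtx ι₁ c →
      N19g_coreAll T V c (T.t34 V c) 2 3) :
    T.allChars.Open_thetaReal34 :=
  (T.allChars_thetaReal34_iff).mpr (T.open_thetaReal34All_of_coreAll h)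

/-- The all-characters core also gives the (34)-side input OF RECORD (monotonicity + `open_thetaReal34_of_core`). -/
theorem open_thetaReal34_of_coreAll
    (h : ∀ {L : CMField} {ι₁ : L →+* ℂ} (V : HermSpace3 L ι₁) (c : SeesawCtx L), T.GoodCtx ι₁ c →
      N19g_coreAll T V c (T.t34 V c) 2 3) :
    T.Open_thetaReal34 :=
  open_thetaReal34_of_core T fun V c hc => N19g_core_of_coreAll T V c (T.t34 V c) 2 3 (h V c hc)

/-- The body of `Open_thetaReal34All` at a good context IS `N19_genInAll T V c (T.t34 V c) 2 3` (definitional;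
recorded so the audit can quote node N19's name for the binder). -/
theorem open_thetaReal34All_of_genInAll
    (h : ∀ {L : CMField} {ι₁ : L →+* ℂ} (V : HermSpace3 L ι₁) (c : SeesawCtx L), T.GoodCtx ι₁ c →
      N19_genInAll T V c (T.t34 V c) 2 3) :
    T.Open_thetaReal34All :=
  fun V c hc => h V c hc

/-- Conversely the all-characters input gives `N19_genInAll` on the (34) side in every good context (so the two are
the same statement, context by context). -/
theorem genInAll34_of_open_thetaReal34All (h : T.Open_thetaReal34All) {L : CMField} {ι₁ : L →+* ℂ}
    (V : HermSpace3 L ι₁) (c : SeesawCtx L) (hc : T.GoodCtx ι₁ c) :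
    N19_genInAll T V c (T.t34 V c) 2 3 :=
  h V c hc

/-- … and `Open_thetaGen12All` gives (wedge ⊆ S₁₂^all) on the (12) side in every good context. -/
theorem wedgeInAll12_of_open_thetaGen12All (h : T.Open_thetaGen12All) {L : CMField} {ι₁ : L →+* ℂ}
    (V : HermSpace3 L ι₁) (c : SeesawCtx L) (hc : T.GoodCtx ι₁ c) :
    N19_wedgeIn T V c (T.t12 V c).allChars 0 1 := by
  intro Γ ω ω' hω hω'
  rw [TorusData.allChars_S12]
  exact h V c hc Γ ω ω' hω hω'

/-! ### The non-design inputs with the two N19 binders in residual-core form -/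

/-- **The non-design inputs with both torus-side binders in RESIDUAL-CORE form**: `embCover`, `innerEmb` [PRINT],
`thetaSub` (N12), `thetaWedge` (N33), `occ` (N29) VERBATIM; the (12)-side seesaw-generator identity (N19w core = node
N17's print heart) and the (34)-side finite-sum core for every character of type `w'` (N19g^all core) in every good
context.  No `chars` field.  A common refinement of `NonDesignInputs` (add `Open_chars`: `nonDesignInputs`) and of
`AllCharsNonDesign` (`allCharsNonDesign`). -/
structure CoresNonDesign : Prop where
  embCover : T.Fact_embCover
  innerEmb : T.Fact_innerEmb
  thetaSub : T.Open_thetaSub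
  thetaWedge : T.Open_thetaWedge
  genIdentity12 : ∀ {L : CMField} {ι₁ : L →+* ℂ} (V : HermSpace3 L ι₁) (c : SeesawCtx L), T.GoodCtx ι₁ c →
    N19w_genIdentity T V c (T.t12 V c) 0 1
  coreAll34 : ∀ {L : CMField} {ι₁ : L →+* ℂ} (V : HermSpace3 L ι₁) (c : SeesawCtx L), T.GoodCtx ι₁ c →
    N19g_coreAll T V c (T.t34 V c) 2 3
  occ : T.Open_occ

/-- **The SEVEN all-characters inputs from the cores** — `chars`-free. -/
theorem CoresNonDesign.allCharsNonDesign {T : U.ThetaModel} (A : T.CoresNonDesign) : T.AllCharsNonDesign :=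
  ⟨A.embCover, A.innerEmb, A.thetaSub, A.thetaWedge, T.open_thetaGen12All_of_genIdentity A.genIdentity12,
    T.open_thetaReal34All_of_coreAll A.coreAll34, A.occ⟩

/-- The EIGHT inputs of record from the cores AND `Open_chars` (node N31), via `OpenInputsN19`. -/
theorem CoresNonDesign.nonDesignInputs {T : U.ThetaModel} (A : T.CoresNonDesign) (hch : T.Open_chars) :
    T.NonDesignInputs :=
  ⟨A.embCover, A.innerEmb, A.thetaSub, A.thetaWedge, open_thetaGen12_of_genIdentity T A.genIdentity12 hch,
    T.open_thetaReal34_of_coreAll A.coreAll34, hch, A.occ⟩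

/-- The ten inputs of the all-characters model `T.allChars` from the cores and the two design constraints of `T`. -/
theorem CoresNonDesign.allCharsInputs {T : U.ThetaModel} (A : T.CoresNonDesign) (hκ : T.Design_kappaConj)
    (hs : T.Design_frameSignConj) : T.allChars.Inputs :=
  (T.allChars_inputs_iff).mpr ⟨A.allCharsNonDesign, hκ, hs⟩

/-! ### END STATES over an arbitrary theta model, cores form -/

/-- **Both realisation inputs from the cores** (+ the model facts, the two design constraints, Hodge–Riemann):
`realisationExists_allChars` at `A.allCharsNonDesign`. -/
theorem realisationExists_ofCores (M : U.ModelAxioms) (A : T.CoresNonDesign) (hκ : T.Design_kappaConj)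
    (hs : T.Design_frameSignConj) (hHR : U.Fact_hodgeRiemann20) :
    U.RealisationExistsPerL ∧ U.RealisationExistsFace :=
  T.realisationExists_allChars M A.allCharsNonDesign hκ hs hHR

/-- **PerL from the cores.** -/
theorem perL_ofCores (M : U.ModelAxioms) (A : T.CoresNonDesign) (hκ : T.Design_kappaConj)
    (hs : T.Design_frameSignConj) (hHR : U.Fact_hodgeRiemann20) : U.PerL :=
  T.perL_allChars M A.allCharsNonDesign hκ hs hHR

/-- **COR-CM, END STATE from the cores.** -/
theorem COR_CM_endState_ofCores (M : U.ModelAxioms) (h29 : U.Fact_weightSpan) (h30 : U.Fact_weightHodge)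
    (hE : U.Qw8ExtProd) (hD : U.Qw8DualPushPull) (hMi : U.Qw8Milne) (A : T.CoresNonDesign)
    (hκ : T.Design_kappaConj) (hs : T.Design_frameSignConj) (hHR : U.Fact_hodgeRiemann20) : U.HC_CM :=
  T.COR_CM_endState_allChars M h29 h30 hE hD hMi A.allCharsNonDesign hκ hs hHR

end ThetaModel

end Universe

/-! ## END STATE over the adelic core DATA, cores form -/

namespace Assembly

open HodgeCM.Universe (AdelicThetaCore₀ SideData ThetaModel)

variable (U : Universe)

/-- **END STATE of part (a) with the two N19 binders in residual-core form and `chars` eliminated —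
`RealisationExistsPerL ∧ RealisationExistsFace`.**  Hypotheses: the model facts `M`; PerL's convention bit `h`; the
core DATA `C`; per context the torus-side data `d12 c`, `d34 c`; the seven inputs of `ThetaModel.CoresNonDesign`
(2 PRINT + N12, N33, N19w core (= N17), N19g^all core, N29); Hodge–Riemann.  It is
`realisationExists_ofSignRecipe₇` at `CoresNonDesign.allCharsNonDesign`. -/
theorem realisationExists_ofSignRecipe₇_ofCores (M : U.ModelAxioms) (h : Bool) (C : U.AdelicThetaCore₀)
    (d12 d34 : ∀ {L : CMField}, SeesawCtx L → SideData L)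
    (A : (C.thetaModel h d12 d34).CoresNonDesign) (hHR : U.Fact_hodgeRiemann20) :
    U.RealisationExistsPerL ∧ U.RealisationExistsFace :=
  realisationExists_ofSignRecipe₇ U M h C d12 d34 A.allCharsNonDesign hHR

/-- **PerL, cores form, `chars` eliminated.** -/
theorem perL_ofSignRecipe₇_ofCores (M : U.ModelAxioms) (h : Bool) (C : U.AdelicThetaCore₀)
    (d12 d34 : ∀ {L : CMField}, SeesawCtx L → SideData L)
    (A : (C.thetaModel h d12 d34).CoresNonDesign) (hHR : U.Fact_hodgeRiemann20) : U.PerL :=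
  perL_ofSignRecipe₇ U M h C d12 d34 A.allCharsNonDesign hHR

/-- The END STATE of record (eight inputs) from the cores AND `Open_chars` of the model — the cores form refines
both END STATES. -/
theorem realisationExists_ofSignRecipe₀_ofCores (M : U.ModelAxioms) (h : Bool) (C : U.AdelicThetaCore₀)
    (d12 d34 : ∀ {L : CMField}, SeesawCtx L → SideData L)
    (A : (C.thetaModel h d12 d34).CoresNonDesign) (hch : (C.thetaModel h d12 d34).Open_chars)
    (hHR : U.Fact_hodgeRiemann20) : U.RealisationExistsPerL ∧ U.RealisationExistsFace :=
  realisationExists_ofSignRecipe₀ U M h C d12 d34 (A.nonDesignInputs hch) hHR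

end Assembly

end HodgeCM

end
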